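import Summits.ResolutionOfSingularities.ResolutionOfSingularities.Theses.HilbertSamuelElimination
import Summits.ResolutionOfSingularities.ResolutionOfSingularities.Theorems.HilbertSamuelEliminationSigmaMaxModificationsReductionBase
import Mathlib.AlgebraicGeometry.Morphisms.Proper
import Mathlib.AlgebraicGeometry.Noetherian
import HarnessLib

/-!
# `SigmaMaxModificationsCorridor3` (crux stmt-ResolutionOfSingularities-19249, route
HilbertSamuelElimination) — line `corridor3_levels`: THE BINDING LEVEL SUFFICES ON THE CLASS
`dim ≤ 3` (strategist, 2026-08-17)

**Crux.** `SigmaMaxModificationsCorridor3`: for every prime `p`, field `k` of characteristic `p`,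
reduced separated finite-type `X/k`, not regular, of dimension EXACTLY `3`, and EVERY level
`N ≥ 3` at which the Hilbert–Samuel locus `X_max(N)` meets `closure (Sing X ∖ X_max(N))`
(corridor condition at level `N`), a `Σ^max`-modification at level `N` (CJS, LNM 2270, Def. 6.15
in modification form; body `B(X, N)` = `HSBody X N` below, inline `H^N = Scheme.hsFun` by `rfl`).

**Line.** The crux quantifies over all levels `N ≥ 3`, and the level matters (`X_max(N+1) ⊊
X_max(N)` happens: refuter kit `Theorems/SigmaMaxModifications/Negative/Levels.lean`). The landed
level raising `stub_levelRaise` (p163333) cannot be used to climb from level `3`: its hypothesis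
at level `N ≥ 4` asks for `B(Y, N)` for ALL `Y/k` of dimension `≤ N`, i.e. for fourfolds — the
sibling crux `SigmaMaxModificationsDimGe4`. The observation of this line: the proof of
`stub_levelRaise` applies its hypothesis ONLY to an open subscheme `U₁ ⊆ X`, and
`dim U₁ ≤ dim X`; so level raising holds VERBATIM on every class of schemes closed under open
subschemes, in particular on `{dim ≤ d}` (`stub_levelRaiseDim`, provable: the proof of
`levelRaise_succ` in `…LevelRaise.lean` with the extra bound threaded through). Hence the crux at
all levels follows from the bodies AT THE BINDING LEVELS `N = dim Y ≤ 3` of the class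
`{dim ≤ 3}`: curves (in tree, `stub_curve` ∘ `stub_curveResolution`, p156715/p156708), surfaces
at level `2` (CJS Thm. 6.28, named fact `CossartJannsenSaito2020_sigmaMaxElimination`, glued by
`sigmaMaxModifications_dim_le_two`, p148824), threefolds with ISOLATED `X_max(3)` (Cossart–Piltant
2019 Thm. 1.1, named fact `CossartPiltant2019General`, via
`sigmaMaxModifications_dim_le_three_of_isolated`, p154168, `X_max(3)` closed by p157713/p158563)
and the single OPEN CORE `stub_corridor3_base` = the crux at the one level `N = 3` (verbatim the
lead's `stub_dim_three_corridor_base` of line `Sketch` on the parent crux and the hypothesis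
`hcor` of `sigmaMaxModifications_of_base_cores`, p164038 — a shared stub, staffed once).

**What this line buys.** It discharges the all-levels quantifier of item 19249 (the corridor
condition at level `N ≥ 4` is simply dropped: the composition proves `B(X, N)` for every
non-regular `X` of the class `{dim ≤ 3}` and every `N ≥ dim X`), reducing the item to
`Corridor3@3` WITHOUT touching dimension `≥ 4`; the previous reductions (`body_allLevels_of_baseLevel`)
needed `DimGe4@base` to pass level `4`.

## Sources

* V. Cossart, U. Jannsen, S. Saito, LNM 2270 (2020): Def. 2.28, Rem. 2.29 (b), Lemma 2.36,
  Def. 6.14/6.15, Cor. 6.18, Thm. 6.28, Rem. 6.29. [CossartJannsenSaito2020]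
* V. Cossart, O. Piltant, J. Algebra 529 (2019), Thm. 1.1, §1. [CossartPiltant2019]
-/

set_option linter.dupNamespace false -- mandated namespace of this single-conjunct summit

noncomputable section

open CategoryTheory AlgebraicGeometry TopologicalSpace Topology
open Literature.AlgebraicGeometry.Resolution Literature.RingTheory.HilbertSamuel
open Summit.ResolutionOfSingularities.ResolutionOfSingularities.Theses.HilbertSamuelElimination
open Summit.ResolutionOfSingularities.ResolutionOfSingularities.Theorems.SigmaMaxModifications.Sketch

namespace Summit.ResolutionOfSingularities.ResolutionOfSingularities.Cruxes.SigmaMaxModificationsCorridor3.Levels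

/-! ## The body -/

/-- `B(X, N)`: the seven-clause body of the crux at level `N` — a proper `π : X' ⟶ X` with `X'`
reduced of dimension `≤ N`, an isomorphism over every open inside `X ∖ X_max(N)` with dense
preimage of `X ∖ X_max(N)`, `H^N` non-increasing, and (ME2) no maximal value of `Σ_X(N)` is a
value of `Σ_{X'}(N)` (CJS Def. 6.15 in modification form; tree vocabulary
`Scheme.hsFun / hsMaxLocus / hsValues`, the route decl's inline `H^N` by `rfl`).
[cite: CossartJannsenSaito2020, Def. 6.15] -/
def HSBody (X : Scheme.{0}) (N : ℕ) : Prop :=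
  ∃ (X' : Scheme.{0}) (π : X' ⟶ X), IsProper π ∧ IsReduced X' ∧
    topologicalKrullDim X' ≤ (N : WithBot ℕ∞) ∧
    (∀ U : X.Opens, (U : Set X) ⊆ (Scheme.hsMaxLocus X N)ᶜ → IsIso (π ∣_ U)) ∧
    Dense ((fun x' => π.base x') ⁻¹' (Scheme.hsMaxLocus X N)ᶜ) ∧
    (∀ x' : X', Scheme.hsFun X' N x' ≤ Scheme.hsFun X N (π.base x')) ∧
    ∀ ν : ℕ → ℕ, Maximal (· ∈ Scheme.hsValues X N) ν → ν ∉ Scheme.hsValues X' N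

/-! ## Stubs: the two printed theorems (named facts of the tree; shared with the parent's lines) -/

/-- **STUB (known in print): `Σ^max`-eliminations of reduced excellent surfaces** — the tree's
named fact `CossartJannsenSaito2020_sigmaMaxElimination` (CJS Def. 6.15 with Thm. 6.28 and
Thm. 3.10 (1), `d ≤ 2`). Used only for surfaces at their binding level `2`.
[cite: CossartJannsenSaito2020, Thm. 6.28, Def. 6.15] -/
theorem stub_cjsSigmaMaxElimination : CossartJannsenSaito2020_sigmaMaxElimination.{0} := by
  sorry

/-- **STUB (known in print): Cossart–Piltant 2019, Thm. 1.1** — the tree's named fact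
`CossartPiltant2019General`. Used only for threefolds with isolated `X_max(3)` at level `3`.
[cite: CossartPiltant2019, Thm. 1.1] -/
theorem stub_cossartPiltant2019General : CossartPiltant2019General.{0} := by
  sorry

/-! ## Stub: dimension-bounded level raising (provable) -/

/-- **STUB `stub_levelRaiseDim` (PROVABLE, M): level raising `N → N + 1` on the class
`{dim ≤ d} ∩ {dim ≤ N}`.** If `B(Y, N)` holds for every reduced separated finite-type non-regular
`Y/k` with `dim Y ≤ d` and `dim Y ≤ N`, then `B(X, N + 1)` holds for every such `X` with
`dim X ≤ d`, `dim X ≤ N`. Proof = the proof of `levelRaise_succ`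
(`Theorems/HilbertSamuelEliminationSigmaMaxModificationsLevelRaise.lean`, p163333) verbatim: the
hypothesis is applied only to the open subscheme
`U₁ = {x | ∃ μ, μ^{(1)} ∈ Σ^max_X(N+1), H^N_X(x) ≤ μ} ⊆ X`, and
`dim U₁ ≤ dim X ≤ d` (`topologicalKrullDim_subspace_le`); everything else (openness of `U₁` by the
sharp semicontinuity p157713/p158563 and finiteness of `Σ_X(N)`, `(U₁)_max(N) = U₁ ∩ X_max(N+1)`,
reading the level-`N` witness at level `N + 1` along `ν ↦ ν^{(1)}` with `Negative.hsFun_succ`,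
gluing with the identity by `sigmaMaxModification_of_localWitness`) is unchanged. The case `d ≥ N`
is `stub_levelRaise` itself. [cite: CossartJannsenSaito2020, Def. 6.15, Rem. 2.29 (b), Lemma 2.36] -/
theorem stub_levelRaiseDim :
    ∀ (k : Type) [Field k] (d N : ℕ),
      (∀ (Y : Scheme.{0}) (g : Y ⟶ Spec (.of k)), IsSeparated g → LocallyOfFiniteType g →
        QuasiCompact g → IsReduced Y → ¬ Scheme.IsRegular Y →
        topologicalKrullDim Y ≤ (d : WithBot ℕ∞) → topologicalKrullDim Y ≤ (N : WithBot ℕ∞) →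
        HSBody Y N) →
      ∀ (X : Scheme.{0}) (f : X ⟶ Spec (.of k)), IsSeparated f → LocallyOfFiniteType f →
        QuasiCompact f → IsReduced X → ¬ Scheme.IsRegular X →
        topologicalKrullDim X ≤ (d : WithBot ℕ∞) → topologicalKrullDim X ≤ (N : WithBot ℕ∞) →
        HSBody X (N + 1) := by
  sorry

/-! ## Stub: the open core at the binding level -/

/-- **STUB (OPEN — the core, load-bearing): `Corridor3@3`.** Threefolds (`dim X = 3`) over a
field of characteristic `p` whose Hilbert–Samuel locus `X_max(3)` meets
`closure (Sing X ∖ X_max(3))`: a `Σ^max`-modification at the ONE level `N = 3`. Verbatim the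
hypothesis `hcor` of `sigmaMaxModifications_of_base_cores` (p164038) and the lead's
`stub_dim_three_corridor_base` (line `Sketch` of the parent crux 18506) — shared, staffed once.
Nothing in print: CJS Rem. 6.29's strategy with O1 (`p = 2`, Thm. 3.14) and O2 (`ē_x = 3`,
Thm. 6.40) open; CP 2019 resolves but is an isomorphism over `Reg X` only, which (ME1) forbids at
corridor points. [cite: CossartJannsenSaito2020, Rem. 6.29, Thm. 6.28] [cite: CossartPiltant2019, §1] -/
theorem stub_corridor3_base :
    ∀ p : ℕ, p.Prime → ∀ (k : Type) [Field k] [CharP k p] (X : Scheme.{0})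
      (f : X ⟶ Spec (.of k)), IsSeparated f → LocallyOfFiniteType f → QuasiCompact f →
      IsReduced X → ¬ Scheme.IsRegular X → ((3 : ℕ) : WithBot ℕ∞) ≤ topologicalKrullDim X →
      topologicalKrullDim X ≤ ((3 : ℕ) : WithBot ℕ∞) →
      ¬ Disjoint (closure ((Scheme.regularLocus X)ᶜ \ Scheme.hsMaxLocus X 3))
          (Scheme.hsMaxLocus X 3) →
        HSBody X 3 := by
  sorry

/-! ## Composition (sorry-free) -/

/-- **Every level on the class `{dim ≤ 3}` from the binding levels.** Over a field `k` of
characteristic `p`: `B(X, N)` for every reduced separated finite-type non-regular `X/k` with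
`dim X ≤ 3` and every `N ≥ dim X`. Induction on `N`: `dim X ≤ N - 1` is `stub_levelRaiseDim`
(`d = 3`) applied to the induction hypothesis; `dim X = N` is a binding level — `N ≤ 1` curves
(p156715/p156708), `N = 2` CJS (p148824), `N = 3` isolated `X_max(3)` (Cossart–Piltant, p154168,
closedness p157713/p158563) or the corridor core `stub_corridor3_base`.
[cite: CossartJannsenSaito2020, Def. 6.15, Rem. 2.29 (b), Rem. 6.29] [cite: CossartPiltant2019, Thm. 1.1] -/
theorem hsBody_of_dim_le_three (p : ℕ) (hp : p.Prime) (k : Type) [Field k] [CharP k p] :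
    ∀ (N : ℕ) (X : Scheme.{0}) (f : X ⟶ Spec (.of k)), IsSeparated f →
      LocallyOfFiniteType f → QuasiCompact f → IsReduced X → ¬ Scheme.IsRegular X →
      topologicalKrullDim X ≤ ((3 : ℕ) : WithBot ℕ∞) → topologicalKrullDim X ≤ (N : WithBot ℕ∞) →
      HSBody X N := by
  intro N
  induction N with
  | zero =>
    intro X f hsep hft hqc hred hreg _ hdim
    exact stub_curve stub_curveResolution k X f hsep hft hqc hred hreg
      (hdim.trans (by exact_mod_cast (by omega : 0 ≤ 1))) 0 hdim
  | succ N ih =>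
    intro X f hsep hft hqc hred hreg hd3 hdim
    rcases dim_le_or_succ_le (topologicalKrullDim X) N with h | h
    · -- `dim X ≤ N`: raise the level on the class `{dim ≤ 3}`
      exact stub_levelRaiseDim k 3 N ih X f hsep hft hqc hred hreg hd3 h
    · -- `dim X = N + 1 ≤ 3`: a binding level
      have hN3 : N + 1 ≤ 3 := by exact_mod_cast h.trans hd3
      rcases Nat.lt_or_ge (N + 1) 2 with h1 | h2
      · -- curves
        exact stub_curve stub_curveResolution k X f hsep hft hqc hred hreg
          (hdim.trans (by exact_mod_cast (by omega : N + 1 ≤ 1))) (N + 1) hdim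
      rcases h2.eq_or_lt with h2 | h3
      · -- surfaces at level `2`
        obtain rfl : N = 1 := by omega
        exact sigmaMaxModifications_dim_le_two stub_cjsSigmaMaxElimination k X f hft hqc hred hreg
          (by exact_mod_cast hdim)
      · -- threefolds at level `3`
        obtain rfl : N = 2 := by omega
        by_cases hdisj : Disjoint (closure ((Scheme.regularLocus X)ᶜ \ Scheme.hsMaxLocus X 3))
            (Scheme.hsMaxLocus X 3)
        · have hcl : IsClosed (Scheme.hsMaxLocus X 3) :=
            (stub_isClosed_hsMaxLocus_over_field stub_hsFun_le_of_specializes_over_field k X f hft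
              hqc 3 hdim).2
          exact sigmaMaxModifications_dim_le_three_of_isolated stub_cossartPiltant2019General k X f
            hsep hft hqc hred hreg (by exact_mod_cast hdim) 3 hdim hcl hdisj
        · exact stub_corridor3_base p hp k X f hsep hft hqc hred hreg h hdim hdisj

/-- **The crux from the stubs — THE REGISTERED COMPOSITION** (sorries only inside the four
`stub_*`): for `dim X = 3` and any level `N ≥ 3` the body is `hsBody_of_dim_le_three`; the
corridor hypothesis at level `N` is not needed (it is used, at `N = 3`, inside the case split of
`hsBody_of_dim_le_three`). The inline `H^N` / `X_max` / `Sing X` of the route decl are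
`Scheme.hsFun` / `Scheme.hsMaxLocus` / `(Scheme.regularLocus X)ᶜ` by `rfl`.
[cite: CossartJannsenSaito2020, Def. 6.15, Rem. 6.29] -/
theorem SigmaMaxModificationsCorridor3_of : SigmaMaxModificationsCorridor3 := by
  intro p hp k _ _ X f hsep hft hqc hred hreg _ h3' N hdim _ _
  exact hsBody_of_dim_le_three p hp k N X f hsep hft hqc hred hreg h3' hdim

/-! ## On-path (sorry-free): the open core is an instance of the crux -/

/-- **On-path `C → stub_corridor3_base`:** the open core is the crux at `N = 3`. -/
theorem corridor3_base_of_corridor3 (h : SigmaMaxModificationsCorridor3) :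
    ∀ p : ℕ, p.Prime → ∀ (k : Type) [Field k] [CharP k p] (X : Scheme.{0})
      (f : X ⟶ Spec (.of k)), IsSeparated f → LocallyOfFiniteType f → QuasiCompact f →
      IsReduced X → ¬ Scheme.IsRegular X → ((3 : ℕ) : WithBot ℕ∞) ≤ topologicalKrullDim X →
      topologicalKrullDim X ≤ ((3 : ℕ) : WithBot ℕ∞) →
      ¬ Disjoint (closure ((Scheme.regularLocus X)ᶜ \ Scheme.hsMaxLocus X 3))
          (Scheme.hsMaxLocus X 3) →
        HSBody X 3 := by
  intro p hp k _ _ X f hsep hft hqc hred hreg h3 h3' hcor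
  exact h p hp k X f hsep hft hqc hred hreg h3 h3' 3 h3' hcor

end Summit.ResolutionOfSingularities.ResolutionOfSingularities.Cruxes.SigmaMaxModificationsCorridor3.Levels

end
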